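import Summits.ResolutionOfSingularities.ResolutionOfSingularities.Theorems.HilbertSamuelEliminationSigmaMaxModificationsCorridor3WLadderStrataDepthStep
import Literature.AlgebraicGeometry.Resolution.FibreCoheightInequalitySharp
import HarnessLib

/-!
# [OURS · L1 W4.2] `Corridor3WLadderStrataDepthRuled` — ROW-J SUPPORT, PER STEP: a DEPTH JUMP through the chain point is carried
# by the fibre; over a SURFACE centre there is none; over a CURVE centre the whole (irreducible) fibre over `x_n` lies in the
# jumping component, hence in `X_{n+1}(ν)`

Crux chain w42 (`SigmaMaxModifications`, stmt-ResolutionOfSingularities-18506; conjunct `SigmaMaxModificationsCorridor3`,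
stmt-ResolutionOfSingularities-19249), object (DG) «ROW-J SUPPORT» (res-L1-w42-plan-1 RULING v3.14-13a (DG) 2026-08-27T10:52Z →
res-type-053: «a depth jump at a cycle end over a CURVE centre D ∋ x_n forces the whole fibre π⁻¹(x_n) (≅ ℙ¹) ⊆ X_{n+1}(ν), in the
order-theoretic currency, typed PER STEP and Q- and strategy-parametric»; consumer: res-type-067's `RebirthDictionary3` / the ROW-J step
lemma `StrataCycleEndNoDepthJumps` (res-D-brk-3)). Seat res-type-053 (gen 10). OURS (cell res-hironaka, slot W4.2); NOT statements of
H. Hironaka's manuscript [Hironaka2017] nor of [CossartJannsenSaito2020]; AI-proved, weaker than expert review. Sorry-free PROOF file: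
no definition, no named fact, no binder, no `CharHypothesis`, no run-level / eventual quantifier — the oracle enters only as the
parameter of `StepProjection R N ν s s' f` (any `R`, so any strategy presented as canonical steps). `--supports stmt-ResolutionOfSingularities-19249 --as helper`.

THE LAW (LIB `Literature/AlgebraicGeometry/Resolution/FibreCoheightInequalitySharp.lean`, Matsumura Thm. 15.1 with the honest
fibre term): `codim_{Z'}(x_{n+1}) ≤ codim_B(x_n) + codim_{Z' ∩ f⁻¹(x_n)}(x_{n+1})` for `B = cl f(Z')`. Hence, with NO hypothesis on
the centre:

* §1 `StepProjection.exists_fibre_generization_of_hasSandwichAt` — **a sandwich at `x_{n+1}` in `Z'` and none at `x_n` in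
  `cl f(Z')` ⇒ `Z'` contains a generisation `z' ≠ x_{n+1}` of `x_{n+1}` INSIDE THE FIBRE `f⁻¹(x_n)`** (any step, any `N`, any
  characteristic; `x_n` closed).

And with the fibre dimension of the permissible blow-up (LIB `PermissibleBlowupFibreDimension.lean`, CJS p. 46 `F = Proj(A)`) at
level `3` under the cycle invariant (canonical centre `C` permissible at `x_n`, `dim 𝒪_{X_n,x_n} ≤ 3`):

* §2 `hasSandwichAt_closure_image_of_surface_centre` — **over a SURFACE centre (`2 ≤ codim_{V(C)}(x_n)`) there is NO depth jump**:
  `HasSandwichAt s' Z' → HasSandwichAt s (cl f(Z'))` (the fibre over `x_n` is finite); by-product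
  `StepProjection.eq_of_specializes_of_base_eq_of_surface_centre` — no two points over `x_n` specialise to one another (for
  res-L1-w42-stub-4 / res-D-pv-038's near-fibre bookkeeping).
* §3 `preimage_pt_subset_of_hasSandwichAt_of_curve_centre` — **over a centre of positive dimension at `x_n` (`1 ≤ codim_{V(C)}(x_n)`,
  so a CURVE at a cycle end) whose fibre `f⁻¹(x_n)` is irreducible (the `ℙ¹ = ℙ(Dir_{x_n}/T_{x_n}D)` of the W-top dictionary), a
  depth jump forces `f⁻¹(x_n) ⊆ Z'`** — so `f⁻¹(x_n) ⊆ X_{n+1}(ν)` when `Z'` is a stratum component: «the whole `ℙ¹` over `x_n` is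
  near», the RULED phenomenon of res-type-067's `RuledBirthDatumD`, read for a dominating component (`RebirthDictionary3`).
-/

noncomputable section

set_option linter.dupNamespace false

open CategoryTheory AlgebraicGeometry TopologicalSpace Topology Order IsLocalRing
open Summit.ResolutionOfSingularities.ResolutionOfSingularities.Theorems.CampaignW42
open Literature.AlgebraicGeometry.Resolution Literature.RingTheory.HilbertSamuel
open Summit.ResolutionOfSingularities.ResolutionOfSingularities.Theorems.SigmaMaxModificationsCorridor3
open Scheme.IdealSheafData

namespace Summit.ResolutionOfSingularities.ResolutionOfSingularities.Theorems.SigmaMaxModificationsCorridor3.Moving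

universe u

variable {R : ∀ S : Scheme.{u}, CentreSeq S → Prop} {N : ℕ} {ν : ℕ → ℕ}

/-! ## §1 A depth jump is carried by the fibre (any step, any level) -/

/-- **A DEPTH JUMP THROUGH THE CHAIN POINT IS CARRIED BY THE FIBRE.** Along a step projection `f : X_{n+1} ⟶ X_n` with `x_n`
closed, for an irreducible closed `Z' ∋ x_{n+1}`: if `Z'` has a sandwich at `x_{n+1}` and `cl f(Z')` has none at `x_n`, then there
is `z' ∈ Z'`, `z' ⤳ x_{n+1}`, `z' ≠ x_{n+1}`, `f z' = x_n` (`Z' ∩ f⁻¹(x_n)` is positive-dimensional at `x_{n+1}`). Matsumura 15.1 with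
the sharp fibre term; no hypothesis on the centre. [cite: Matsumura1987, Thm. 15.1] -/
theorem StepProjection.exists_fibre_generization_of_hasSandwichAt {s s' : MarkedStage.{u}} {f : s'.W ⟶ s.W}
    (hf : StepProjection R N ν s s' f) (hsc : IsClosed ({s.pt} : Set s.W)) {Z' : Set s'.W} (hirr : IsIrreducible Z')
    (hcl : IsClosed Z') (hx' : s'.pt ∈ Z') (hup : HasSandwichAt s' Z') (hdown : ¬ HasSandwichAt s (closure (f.base '' Z'))) :
    ∃ z' ∈ Z', z' ⤳ s'.pt ∧ z' ≠ s'.pt ∧ f.base z' = s.pt := by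
  haveI := s.ln
  haveI := s'.ln
  have hgen : IsGenericPoint hirr.genericPoint Z' := hirr.isGenericPoint_genericPoint hcl
  set ζ' := hirr.genericPoint with hζ'def
  have hsp : ζ' ⤳ s'.pt := hgen.specializes hx'
  have hfx : f.base s'.pt = s.pt := hf.base_pt
  have hirrB : IsIrreducible (closure (f.base '' Z')) := (hirr.image f.base f.continuous.continuousOn).closure
  have hBeq : closure (f.base '' Z') = closure {f.base ζ'} := by
    apply le_antisymm
    · refine closure_minimal ?_ isClosed_closure
      rintro _ ⟨z, hz, rfl⟩
      exact specializes_iff_mem_closure.mp ((hgen.specializes hz).map f.continuous)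
    · exact closure_minimal (Set.singleton_subset_iff.mpr (subset_closure ⟨ζ', hgen.mem, rfl⟩)) isClosed_closure
  -- `2 ≤ codim_{Z'}(x')`, `codim_B(x_n) ≤ 1`
  have h2 : 2 ≤ coheight (⟨s'.pt, hx'⟩ : ↥Z') := (two_le_coheight_iff_exists_sandwich hirr hcl hx' hf.isClosed_pt).mpr hup
  have hB1 : coheight (⟨s.pt, subset_closure ⟨s'.pt, hx', hfx⟩⟩ : ↥(closure (f.base '' Z'))) ≤ 1 := by
    by_contra hlt
    exact hdown ((two_le_coheight_iff_exists_sandwich hirrB isClosed_closure (subset_closure ⟨s'.pt, hx', hfx⟩) hsc).mp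
      (by
        have : (1 : ℕ∞) < coheight (⟨s.pt, subset_closure ⟨s'.pt, hx', hfx⟩⟩ : ↥(closure (f.base '' Z'))) := not_le.mp hlt
        exact Order.add_one_le_of_lt this))
  -- transport to the closures of the generic points
  have e1 : coheight (⟨s'.pt, hx'⟩ : ↥Z') = coheight (⟨s'.pt, specializes_iff_mem_closure.mp hsp⟩ : ↥(closure ({ζ'} : Set s'.W))) :=
    (coheight_orderIso (OrderIso.setCongr _ _ hgen.def.symm) ⟨s'.pt, hx'⟩).symm
  have e2 : coheight (⟨s.pt, subset_closure ⟨s'.pt, hx', hfx⟩⟩ : ↥(closure (f.base '' Z'))) =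
      coheight (⟨f.base s'.pt, specializes_iff_mem_closure.mp (hsp.map f.continuous)⟩ : ↥(closure ({f.base ζ'} : Set s.W))) := by
    have e : (⟨s.pt, subset_closure ⟨s'.pt, hx', hfx⟩⟩ : ↥(closure (f.base '' Z'))) =
        ⟨f.base s'.pt, subset_closure ⟨s'.pt, hx', rfl⟩⟩ := Subtype.ext hfx.symm
    rw [e]
    exact (coheight_orderIso (OrderIso.setCongr (closure (f.base '' Z')) (closure ({f.base ζ'} : Set s.W)) hBeq)
      ⟨f.base s'.pt, subset_closure ⟨s'.pt, hx', rfl⟩⟩).symm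
  have hlt : coheight (⟨f.base s'.pt, specializes_iff_mem_closure.mp (hsp.map f.continuous)⟩ : ↥(closure ({f.base ζ'} : Set s.W))) <
      coheight (⟨s'.pt, specializes_iff_mem_closure.mp hsp⟩ : ↥(closure ({ζ'} : Set s'.W))) := by
    rw [← e1, ← e2]
    exact lt_of_le_of_lt hB1 (lt_of_lt_of_le (by decide) h2)
  obtain ⟨z', hζz, hzx, hne, hfz⟩ := exists_mem_fibre_specializes_of_coheight_lt f hsp hlt
  refine ⟨z', ?_, hzx, hne, by rw [hfz, hfx]⟩
  rw [← hgen.def]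
  exact specializes_iff_mem_closure.mp hζz

/-! ## §2 Over a SURFACE centre there is no depth jump (level 3, cycle invariant) -/

/-- **NO DEPTH JUMP OVER A SURFACE CENTRE.** For one canonical near step `s → s'` at level `3` under the cycle invariant
(admissible functional oracle, `ν ≠ Φ^{(3)}`), `x_n` closed, read through its step projection `f`, with canonical centre `C` of
codimension `≥ 2` at `x_n` inside its support («surface»): for every irreducible closed `Z' ∋ x_{n+1}`, a sandwich at `x_{n+1}` in
`Z'` forces a sandwich at `x_n` in `cl f(Z')` (the fibre of the permissible blow-up over `x_n` is finite: `dim 𝒪_{X_n,x_n} ≤ 3 ≤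
dim 𝒪_{V(C),x_n} + 1`). [cite: CossartJannsenSaito2020, Thm. 3.10 (proof, p. 46)] [cite: Matsumura1987, Thm. 15.1] -/
theorem hasSandwichAt_closure_image_of_surface_centre {k : Type u} [Field k] (hRf : OracleFunctional R) (hRa : OracleAdmissible R)
    (hν : ν ≠ iterPSum 3 Phi) {s s' : MarkedStage.{u}} (h : CycleInv k R 3 ν s) (hsc : IsClosed ({s.pt} : Set s.W))
    {f : s'.W ⟶ s.W} (hf : StepProjection R 3 ν s s' f) {C : s.W.IdealSheafData} {P' : Option (Pending (blowup C))}
    (hcs : IsCanonicalStep R 3 ν s.L s.P C P') (hxC : s.pt ∈ (C.support : Set s.W))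
    (hsurf : 2 ≤ coheight (⟨s.pt, hxC⟩ : ↥(C.support : Set s.W))) {Z' : Set s'.W} (hirr : IsIrreducible Z')
    (hcl : IsClosed Z') (hx' : s'.pt ∈ Z') (hup : HasSandwichAt s' Z') : HasSandwichAt s (closure (f.base '' Z')) := by
  by_contra hdown
  haveI := s.ln
  haveI := s'.ln
  -- `f` is the blow-up in `C` (functional oracle: the canonical centre is unique)
  obtain ⟨C₀, P₀, hcs₀, hbl⟩ := hf.exists_isCanonicalStep_and_isBlowup
  obtain rfl : C = C₀ := hcs.centre_unique hRf hcs₀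
  obtain ⟨-, -, hpermC, -⟩ := h.centre hRa hν hcs
  have hfx : f.base s'.pt = s.pt := hf.base_pt
  -- the data at `y = f x' = x_n`
  have hyC : f.base s'.pt ∈ (C.support : Set s.W) := by rw [hfx]; exact hxC
  have hperm : IdealSheafData.IsPermissibleAt C (f.base s'.pt) := hpermC _ hyC
  haveI hregC : IsRegularLocalRing (s.W.presheaf.stalk (f.base s'.pt) ⧸ stalkIdeal C (f.base s'.pt)) := hperm.1
  obtain ⟨d, hd⟩ : ∃ d : ℕ, ringKrullDim (s.W.presheaf.stalk (f.base s'.pt) ⧸ stalkIdeal C (f.base s'.pt)) = d :=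
    exists_nat_eq_of_ne_bot_of_ne_top ringKrullDim_ne_bot ringKrullDim_ne_top
  have h2d : 2 ≤ d := by
    have h1 : ((coheight (⟨f.base s'.pt, hyC⟩ : ↥(C.support : Set s.W)) : ℕ∞) : WithBot ℕ∞) ≤ (((d : ℕ) : ℕ∞) : WithBot ℕ∞) := by
      have h1 := coheight_le_ringKrullDim_quotient_stalkIdeal C hyC
      rw [hd] at h1
      rwa [← WithBot.coe_natCast] at h1
    have e : (⟨s.pt, hxC⟩ : ↥(C.support : Set s.W)) = ⟨f.base s'.pt, hyC⟩ := Subtype.ext hfx.symm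
    have h3 : ((2 : ℕ) : ℕ∞) ≤ (d : ℕ∞) := by
      have h4 : (2 : ℕ∞) ≤ (d : ℕ∞) := (e ▸ hsurf).trans (WithBot.coe_le_coe.mp h1)
      exact_mod_cast h4
    exact_mod_cast h3
  have hdimX : ringKrullDim (s.W.presheaf.stalk (f.base s'.pt)) ≤ ((d + 1 + 0 : ℕ) : WithBot ℕ∞) := by
    have hyX : coheight (f.base s'.pt) ≤ (3 : ℕ) := (topologicalKrullDim_le_iff_forall_coheight_le s.W 3).mp h.dim_le _
    rw [AlgebraicGeometry.ringKrullDim_stalk_eq_coheight]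
    have h1 : ((coheight (f.base s'.pt) : ℕ∞) : WithBot ℕ∞) ≤ (((3 : ℕ) : ℕ∞) : WithBot ℕ∞) := WithBot.coe_le_coe.mpr hyX
    rw [WithBot.coe_natCast] at h1
    exact h1.trans (by exact_mod_cast (by omega : 3 ≤ d + 1 + 0))
  -- the generic point and Matsumura
  have hgen : IsGenericPoint hirr.genericPoint Z' := hirr.isGenericPoint_genericPoint hcl
  set ζ' := hirr.genericPoint with hζ'def
  have hsp : ζ' ⤳ s'.pt := hgen.specializes hx'
  have key := hbl.coheight_closure_le_add_of_isPermissibleAt hsp hperm hd (e := 0) hdimX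
  rw [Nat.cast_zero, add_zero] at key
  -- sandwiches ↔ codimensions, transported to the closures
  have h2 : 2 ≤ coheight (⟨s'.pt, hx'⟩ : ↥Z') := (two_le_coheight_iff_exists_sandwich hirr hcl hx' hf.isClosed_pt).mpr hup
  have hirrB : IsIrreducible (closure (f.base '' Z')) := (hirr.image f.base f.continuous.continuousOn).closure
  have hBeq : closure (f.base '' Z') = closure {f.base ζ'} := by
    apply le_antisymm
    · refine closure_minimal ?_ isClosed_closure
      rintro _ ⟨z, hz, rfl⟩
      exact specializes_iff_mem_closure.mp ((hgen.specializes hz).map f.continuous)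
    · exact closure_minimal (Set.singleton_subset_iff.mpr (subset_closure ⟨ζ', hgen.mem, rfl⟩)) isClosed_closure
  have e1 : coheight (⟨s'.pt, hx'⟩ : ↥Z') = coheight (⟨s'.pt, specializes_iff_mem_closure.mp hsp⟩ : ↥(closure ({ζ'} : Set s'.W))) :=
    (coheight_orderIso (OrderIso.setCongr _ _ hgen.def.symm) ⟨s'.pt, hx'⟩).symm
  have e2 : coheight (⟨f.base s'.pt, subset_closure ⟨s'.pt, hx', rfl⟩⟩ : ↥(closure (f.base '' Z'))) =
      coheight (⟨f.base s'.pt, specializes_iff_mem_closure.mp (hsp.map f.continuous)⟩ : ↥(closure ({f.base ζ'} : Set s.W))) :=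
    (coheight_orderIso (OrderIso.setCongr (closure (f.base '' Z')) (closure ({f.base ζ'} : Set s.W)) hBeq)
      ⟨f.base s'.pt, subset_closure ⟨s'.pt, hx', rfl⟩⟩).symm
  have hB2 : 2 ≤ coheight (⟨f.base s'.pt, subset_closure ⟨s'.pt, hx', rfl⟩⟩ : ↥(closure (f.base '' Z'))) := by
    rw [e2]; exact (e1 ▸ h2).trans key
  apply hdown
  have e : (⟨f.base s'.pt, subset_closure ⟨s'.pt, hx', rfl⟩⟩ : ↥(closure (f.base '' Z'))) =
      ⟨s.pt, subset_closure ⟨s'.pt, hx', hfx⟩⟩ := Subtype.ext hfx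
  exact (two_le_coheight_iff_exists_sandwich hirrB isClosed_closure (subset_closure ⟨s'.pt, hx', hfx⟩) hsc).mp (e ▸ hB2)

/-- **By-product: over a surface centre no two points of the fibre over `x_n` specialise to one another** (the fibre of the
permissible blow-up is zero-dimensional; for stub-4 / res-D-pv-038's near-fibre bookkeeping).
[cite: CossartJannsenSaito2020, Thm. 3.10 (proof, p. 46)] -/
theorem StepProjection.eq_of_specializes_of_base_eq_of_surface_centre {k : Type u} [Field k] (hRf : OracleFunctional R)
    (hRa : OracleAdmissible R) (hν : ν ≠ iterPSum 3 Phi) {s s' : MarkedStage.{u}} (h : CycleInv k R 3 ν s)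
    {f : s'.W ⟶ s.W} (hf : StepProjection R 3 ν s s' f) {C : s.W.IdealSheafData} {P' : Option (Pending (blowup C))}
    (hcs : IsCanonicalStep R 3 ν s.L s.P C P') (hxC : s.pt ∈ (C.support : Set s.W))
    (hsurf : 2 ≤ coheight (⟨s.pt, hxC⟩ : ↥(C.support : Set s.W))) {z' w' : s'.W} (hzw : z' ⤳ w')
    (hz : f.base z' = s.pt) (hw : f.base w' = s.pt) : z' = w' := by
  haveI := s.ln
  haveI := s'.ln
  obtain ⟨C₀, P₀, hcs₀, hbl⟩ := hf.exists_isCanonicalStep_and_isBlowup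
  obtain rfl : C = C₀ := hcs.centre_unique hRf hcs₀
  obtain ⟨-, -, hpermC, -⟩ := h.centre hRa hν hcs
  have hwC : f.base w' ∈ (C.support : Set s.W) := by rw [hw]; exact hxC
  have hperm : IdealSheafData.IsPermissibleAt C (f.base w') := hpermC _ hwC
  haveI hregC : IsRegularLocalRing (s.W.presheaf.stalk (f.base w') ⧸ stalkIdeal C (f.base w')) := hperm.1
  obtain ⟨d, hd⟩ : ∃ d : ℕ, ringKrullDim (s.W.presheaf.stalk (f.base w') ⧸ stalkIdeal C (f.base w')) = d :=
    exists_nat_eq_of_ne_bot_of_ne_top ringKrullDim_ne_bot ringKrullDim_ne_top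
  have h2d : 2 ≤ d := by
    have h1 : ((coheight (⟨f.base w', hwC⟩ : ↥(C.support : Set s.W)) : ℕ∞) : WithBot ℕ∞) ≤ (((d : ℕ) : ℕ∞) : WithBot ℕ∞) := by
      have h1 := coheight_le_ringKrullDim_quotient_stalkIdeal C hwC
      rw [hd] at h1
      rwa [← WithBot.coe_natCast] at h1
    have e : (⟨s.pt, hxC⟩ : ↥(C.support : Set s.W)) = ⟨f.base w', hwC⟩ := Subtype.ext hw.symm
    have h3 : ((2 : ℕ) : ℕ∞) ≤ (d : ℕ∞) := by
      have h4 : (2 : ℕ∞) ≤ (d : ℕ∞) := (e ▸ hsurf).trans (WithBot.coe_le_coe.mp h1)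
      exact_mod_cast h4
    exact_mod_cast h3
  have hdimX : ringKrullDim (s.W.presheaf.stalk (f.base w')) ≤ ((d + 1 : ℕ) : WithBot ℕ∞) := by
    have hyX : coheight (f.base w') ≤ (3 : ℕ) := (topologicalKrullDim_le_iff_forall_coheight_le s.W 3).mp h.dim_le _
    rw [AlgebraicGeometry.ringKrullDim_stalk_eq_coheight]
    have h1 : ((coheight (f.base w') : ℕ∞) : WithBot ℕ∞) ≤ (((3 : ℕ) : ℕ∞) : WithBot ℕ∞) := WithBot.coe_le_coe.mpr hyX
    rw [WithBot.coe_natCast] at h1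
    exact h1.trans (by exact_mod_cast (by omega : 3 ≤ d + 1))
  exact hbl.eq_of_specializes_of_base_eq hzw (hz.trans hw.symm) hperm hd hdimX

/-! ## §3 Over a CURVE centre a depth jump swallows the irreducible fibre (level 3, cycle invariant) -/

/-- **A DEPTH JUMP OVER A CURVE CENTRE SWALLOWS THE FIBRE.** For one canonical near step `s → s'` at level `3` under the cycle
invariant (admissible functional oracle, `ν ≠ Φ^{(3)}`), `x_n` closed, step projection `f`, canonical centre `C` of POSITIVE
dimension at `x_n` inside its support (`1 ≤ codim_{V(C)}(x_n)`; at a cycle end: a curve), and an IRREDUCIBLE fibre `f⁻¹(x_n)`: for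
every irreducible closed `Z' ∋ x_{n+1}` with a sandwich at `x_{n+1}` and no sandwich at `x_n` in `cl f(Z')`, the whole fibre lies
in `Z'`: `f⁻¹(x_n) ⊆ Z'` (the fibre has codimension `≤ 1` at `x_{n+1}` — `dim 𝒪_{X_n,x_n} ≤ 3 ≤ dim 𝒪_{V(C),x_n} + 2` — and `Z'`
meets it in a generisation of `x_{n+1}`, which must be its generic point). With `Z' ⊆ X_{n+1}(ν)` a stratum component:
`f⁻¹(x_n) ⊆ X_{n+1}(ν)`, the «whole `ℙ¹` near» event. [cite: CossartJannsenSaito2020, Thm. 3.10 (proof, p. 46)]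
[cite: Matsumura1987, Thm. 15.1] -/
theorem preimage_pt_subset_of_hasSandwichAt_of_curve_centre {k : Type u} [Field k] (hRf : OracleFunctional R)
    (hRa : OracleAdmissible R) (hν : ν ≠ iterPSum 3 Phi) {s s' : MarkedStage.{u}} (h : CycleInv k R 3 ν s)
    (hsc : IsClosed ({s.pt} : Set s.W)) {f : s'.W ⟶ s.W} (hf : StepProjection R 3 ν s s' f) {C : s.W.IdealSheafData}
    {P' : Option (Pending (blowup C))} (hcs : IsCanonicalStep R 3 ν s.L s.P C P') (hxC : s.pt ∈ (C.support : Set s.W))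
    (hpos : 1 ≤ coheight (⟨s.pt, hxC⟩ : ↥(C.support : Set s.W))) (hF : IsIrreducible (f.base ⁻¹' {s.pt}))
    {Z' : Set s'.W} (hirr : IsIrreducible Z') (hcl : IsClosed Z') (hx' : s'.pt ∈ Z') (hup : HasSandwichAt s' Z')
    (hdown : ¬ HasSandwichAt s (closure (f.base '' Z'))) : f.base ⁻¹' {s.pt} ⊆ Z' := by
  haveI := s.ln
  haveI := s'.ln
  obtain ⟨C₀, P₀, hcs₀, hbl⟩ := hf.exists_isCanonicalStep_and_isBlowup
  obtain rfl : C = C₀ := hcs.centre_unique hRf hcs₀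
  obtain ⟨-, -, hpermC, -⟩ := h.centre hRa hν hcs
  have hfx : f.base s'.pt = s.pt := hf.base_pt
  -- the generisation of `x'` inside `Z' ∩ f⁻¹(x_n)`
  obtain ⟨z', hz'Z, hzx, hne, hfz⟩ := hf.exists_fibre_generization_of_hasSandwichAt hsc hirr hcl hx' hup hdown
  -- the fibre has codimension `≤ 1` at `x'`
  have hyC : f.base s'.pt ∈ (C.support : Set s.W) := by rw [hfx]; exact hxC
  have hperm : IdealSheafData.IsPermissibleAt C (f.base s'.pt) := hpermC _ hyC
  haveI hregC : IsRegularLocalRing (s.W.presheaf.stalk (f.base s'.pt) ⧸ stalkIdeal C (f.base s'.pt)) := hperm.1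
  obtain ⟨d, hd⟩ : ∃ d : ℕ, ringKrullDim (s.W.presheaf.stalk (f.base s'.pt) ⧸ stalkIdeal C (f.base s'.pt)) = d :=
    exists_nat_eq_of_ne_bot_of_ne_top ringKrullDim_ne_bot ringKrullDim_ne_top
  have h1d : 1 ≤ d := by
    have h1 : ((coheight (⟨f.base s'.pt, hyC⟩ : ↥(C.support : Set s.W)) : ℕ∞) : WithBot ℕ∞) ≤ (((d : ℕ) : ℕ∞) : WithBot ℕ∞) := by
      have h1 := coheight_le_ringKrullDim_quotient_stalkIdeal C hyC
      rw [hd] at h1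
      rwa [← WithBot.coe_natCast] at h1
    have e : (⟨s.pt, hxC⟩ : ↥(C.support : Set s.W)) = ⟨f.base s'.pt, hyC⟩ := Subtype.ext hfx.symm
    have h3 : ((1 : ℕ) : ℕ∞) ≤ (d : ℕ∞) := by
      have h4 : (1 : ℕ∞) ≤ (d : ℕ∞) := (e ▸ hpos).trans (WithBot.coe_le_coe.mp h1)
      exact_mod_cast h4
    exact_mod_cast h3
  have hdimX : ringKrullDim (s.W.presheaf.stalk (f.base s'.pt)) ≤ ((d + 1 + 1 : ℕ) : WithBot ℕ∞) := by
    have hyX : coheight (f.base s'.pt) ≤ (3 : ℕ) := (topologicalKrullDim_le_iff_forall_coheight_le s.W 3).mp h.dim_le _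
    rw [AlgebraicGeometry.ringKrullDim_stalk_eq_coheight]
    have h1 : ((coheight (f.base s'.pt) : ℕ∞) : WithBot ℕ∞) ≤ (((3 : ℕ) : ℕ∞) : WithBot ℕ∞) := WithBot.coe_le_coe.mpr hyX
    rw [WithBot.coe_natCast] at h1
    exact h1.trans (by exact_mod_cast (by omega : 3 ≤ d + 1 + 1))
  have hF1 : coheight (⟨s'.pt, rfl⟩ : ↥(f.base ⁻¹' {f.base s'.pt})) ≤ 1 :=
    hbl.coheight_preimage_le_of_isPermissibleAt s'.pt hperm hd (e := 1) hdimX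
  -- transport to the fibre over `x_n` and conclude
  have hFeq : f.base ⁻¹' {f.base s'.pt} = f.base ⁻¹' {s.pt} := by rw [hfx]
  have hx'F : s'.pt ∈ f.base ⁻¹' {s.pt} := by show f.base s'.pt ∈ ({s.pt} : Set s.W); rw [hfx]; rfl
  have hF1' : coheight (⟨s'.pt, hx'F⟩ : ↥(f.base ⁻¹' {s.pt})) ≤ 1 := by
    have e := coheight_orderIso (OrderIso.setCongr _ _ hFeq) ⟨s'.pt, rfl⟩
    rw [← e] at hF1
    exact hF1
  have hFcl : IsClosed (f.base ⁻¹' {s.pt}) := hsc.preimage f.continuous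
  have hgen : IsGenericPoint hirr.genericPoint Z' := hirr.isGenericPoint_genericPoint hcl
  have hsub := subset_closure_of_mem_of_coheight_le_one hF hFcl hx'F hF1' (z' := z') hfz hzx hne
    (hgen.specializes hz'Z)
  rw [hgen.def] at hsub
  exact hsub

end Summit.ResolutionOfSingularities.ResolutionOfSingularities.Theorems.SigmaMaxModificationsCorridor3.Moving

end
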